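import Literature.NumberTheory.QuadraticFields.ImaginaryQuadraticPrescribedSplittingInert
import Literature.NumberTheory.DiophantineGeometry.Conductor
import Mathlib.NumberTheory.LegendreSymbol.JacobiSymbol
import HarnessLib

/-!
# The (def)-configured auxiliary prime of line `lower-chamber-door` EXISTS — its support stub
# `stub_defField` discharged (crux 3 `KobayashiLowerHalfLargeImage`, item stmt-BirchSwinnertonDyer-19001,
# route `SignedLowerHalves`; cell `bsd-ssimc`, lead seat `bsd-line-slh-p1` gen 15; `--supports`, helper)

The published, triaged (round 1: 2/2 PASS) but UNREGISTERED line
`Cruxes/KobayashiLowerHalfLargeImage/Lines/lower_chamber_door.lean` (ideator K1 g23, crux-plan g0) runs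
Burungale–Skinner–Tian–Wan's Thm. 2.5 (def) at an X7 pair `(W, p)` over an imaginary quadratic field
`L = ℚ(√-D)` in which `p` SPLITS, one `ρ̄`-ramified Steinberg prime `ℓ ∉ {2, p}` is INERT, and every other odd
prime of the conductor SPLITS; `D` prime, `D ≡ 7 (mod 8)` (so `2` splits and `-D` is a fundamental
discriminant), `D ∉ {p, ℓ}`, `D ∤ N_W`. Its stub `stub_defField : DefFieldStatement` asserts that such a `D`
exists for every elliptic `W/ℚ` and all distinct odd primes `p, ℓ`. This file proves that statement — body
VERBATIM, the line's `IsDefConfig W p ℓ D` unfolded (the `Cruxes/…/Lines` module is a workfile, not an importable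
olean, so the statement cannot be cited by name; a registration of the line closes its stub by
`exact Theorems.LowerChamberDoor.defFieldStatement`). Proof = ONE application of the tree's Dirichlet-plus-CRT
theorem `Quadratic.exists_prime_prescribed_residues` (split set `({p} ∪ primes(N_W)) \ {ℓ}`, inert set `{ℓ}`,
bound `N_W + p + ℓ`; `N_W ≠ 0` by `conductorNorm_pos_holds`): the prime `r` it returns has `r ≡ 7 (mod 8)`,
`r ≡ -1 (mod s)` at every odd `s` of the split set (so `(-r | s) = (1 | s) = 1`) and `-r` a non-residue mod `ℓ`
(so `(-r | ℓ) = -1`). ADAPTED from the crux-triage seat r1-1 (gen 10)'s kernel evidence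
`Cruxes/KobayashiLowerHalfLargeImage/TRIAGE_r1_1_DefField.lean` (sorry-free there; triage seats do not write
under `Theorems/`), namespace and statement shape adjusted, proof unchanged in substance.

HONEST FRAMING (D-0152, cell bsd-ssimc): a SUPPORT statement (size S: Dirichlet + CRT + reciprocity
bookkeeping) of an unregistered line; it touches neither that line's engine `stub_lowerChamber`, nor the line
of record `kurihara_rigidity`, nor the crux, nor the route; nothing is booked; BSD is not proved by any of
this. `--supports stmt-BirchSwinnertonDyer-19001` (helper). No definition, no named fact, no sorry.

References: [BurungaleSkinnerTianWan2024] Thm. 2.5 (def) (the chamber); Dirichlet's theorem on primes in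
progressions and quadratic reciprocity via the tree's `Quadratic.exists_prime_prescribed_residues`
(`Literature/NumberTheory/QuadraticFields/ImaginaryQuadraticPrescribedSplittingInert.lean`).
-/

set_option autoImplicit false
-- single-problem summit (D-0017): the doubled namespace component is by design
set_option linter.dupNamespace false

noncomputable section

open scoped Classical

open WeierstrassCurve

namespace Summit.BirchSwinnertonDyer.BirchSwinnertonDyer.Theorems.LowerChamberDoor

/-- Residue bookkeeping at a SPLIT prime: if `r ≡ -1 (mod s)` then `(-r | s) = (1 | s) = 1`
(Mathlib `jacobiSym.mod_left'`, `jacobiSym.one_left`). [folklore] -/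
private theorem jacobiSym_neg_eq_one_of_cast_eq_neg_one {r s : ℕ} (h : (r : ZMod s) = -1) :
    jacobiSym (-(r : ℤ)) s = 1 := by
  have h1 : ((-(r : ℤ) : ℤ) : ZMod s) = ((1 : ℤ) : ZMod s) := by
    rw [Int.cast_neg, Int.cast_natCast, Int.cast_one, h, neg_neg]
  rw [ZMod.intCast_eq_intCast_iff'] at h1
  rw [jacobiSym.mod_left' h1, jacobiSym.one_left]

/-- Residue bookkeeping at the INERT prime: if `-r` is a non-square mod the prime `ℓ` then
`(-r | ℓ) = -1` (Mathlib `ZMod.nonsquare_iff_jacobiSym_eq_neg_one`). [folklore] -/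
private theorem jacobiSym_neg_eq_neg_one_of_not_isSquare {r ℓ : ℕ} (hℓ : ℓ.Prime)
    (h : ¬ IsSquare (-(r : ZMod ℓ))) : jacobiSym (-(r : ℤ)) ℓ = -1 := by
  haveI : Fact ℓ.Prime := ⟨hℓ⟩
  rw [ZMod.nonsquare_iff_jacobiSym_eq_neg_one, Int.cast_neg, Int.cast_natCast]
  exact h

/-- **The (def)-configured prime exists — `stub_defField` of line `lower-chamber-door`, its statement
`DefFieldStatement` VERBATIM with `IsDefConfig W p ℓ D` unfolded.** For an elliptic `W/ℚ` and distinct odd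
primes `p, ℓ` there is a prime `D` with `D ≡ 7 (mod 8)`, `D ≠ p`, `D ≠ ℓ`, `D ∤ N_W`, `(-D | p) = 1` (`p` splits in
`ℚ(√-D)`), `(-D | ℓ) = -1` (`ℓ` inert) and `(-D | r) = 1` at every odd prime `r ≠ ℓ` dividing the conductor
(every other bad prime splits). Proof: `Quadratic.exists_prime_prescribed_residues` with split set
`({p} ∪ primes(N_W)) \ {ℓ}`, inert set `{ℓ}`, bound `N_W + p + ℓ`. Adapted from the crux-triage r1-1 (gen 10)
kernel evidence `TRIAGE_r1_1_DefField.lean`. [cite: BurungaleSkinnerTianWan2024, Thm. 2.5 (def) — the configuration] -/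
theorem defFieldStatement :
    ∀ (W : WeierstrassCurve ℚ) [W.IsElliptic] (p ℓ : ℕ), p.Prime → ℓ.Prime → p ≠ 2 → ℓ ≠ 2 → p ≠ ℓ →
      ∃ D : ℕ, D.Prime ∧ D % 8 = 7 ∧ D ≠ p ∧ D ≠ ℓ ∧ ¬ (D ∣ W.conductorNorm ℤ) ∧
        jacobiSym (-(D : ℤ)) p = 1 ∧ jacobiSym (-(D : ℤ)) ℓ = -1 ∧
        ∀ r : ℕ, r.Prime → r ≠ 2 → r ≠ ℓ → r ∣ W.conductorNorm ℤ → jacobiSym (-(D : ℤ)) r = 1 := by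
  intro W _ p ℓ hp hℓ hp2 hℓ2 hpℓ
  classical
  have hN0 : W.conductorNorm ℤ ≠ 0 := (W.conductorNorm_pos_holds).ne'
  set N : ℕ := W.conductorNorm ℤ with hN
  set S : Finset ℕ := (insert p N.primeFactors).erase ℓ with hS_def
  have hS : ∀ s ∈ S, s.Prime := by
    intro s hs
    rw [hS_def, Finset.mem_erase, Finset.mem_insert] at hs
    rcases hs.2 with h | h
    · exact h ▸ hp
    · exact Nat.prime_of_mem_primeFactors h
  have hT : ∀ q ∈ ({ℓ} : Finset ℕ), q.Prime := by
    intro q hq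
    rw [Finset.mem_singleton] at hq
    exact hq ▸ hℓ
  have hST : Disjoint S ({ℓ} : Finset ℕ) := by
    rw [Finset.disjoint_singleton_right, hS_def]
    exact Finset.notMem_erase ℓ _
  obtain ⟨r, hr, hrn, -, -, -, h8, -, hSres, hTres⟩ :=
    Literature.NumberTheory.QuadraticFields.Quadratic.exists_prime_prescribed_residues S {ℓ} hS hT
      hST (N + p + ℓ)
  have h2T : (2 : ℕ) ∉ ({ℓ} : Finset ℕ) := by
    rw [Finset.mem_singleton]
    exact fun h ↦ hℓ2 h.symm
  refine ⟨r, hr, h8 h2T, by omega, by omega, ?_, ?_, ?_, ?_⟩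
  · -- `D ∤ N_W`: `D` is a prime beyond `N_W ≥ 1`
    intro h
    have := Nat.le_of_dvd (Nat.pos_of_ne_zero hN0) h
    omega
  · -- `p` split: `p ∈ S` is odd, so `r ≡ -1 (mod p)` and `(-r | p) = 1`
    have hpS : p ∈ S := by
      rw [hS_def, Finset.mem_erase]
      exact ⟨hpℓ, Finset.mem_insert_self _ _⟩
    exact jacobiSym_neg_eq_one_of_cast_eq_neg_one (hSres p hpS hp2)
  · -- `ℓ` inert: `-r` is a non-residue mod `ℓ`
    exact jacobiSym_neg_eq_neg_one_of_not_isSquare hℓ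
      (hTres ℓ (Finset.mem_singleton_self ℓ) hℓ2).2
  · -- every other odd prime of the conductor splits
    intro s hs hs2 hsℓ hsN
    have hsS : s ∈ S := by
      rw [hS_def, Finset.mem_erase, Finset.mem_insert, Nat.mem_primeFactors]
      exact ⟨hsℓ, Or.inr ⟨hs, hsN, hN0⟩⟩
    exact jacobiSym_neg_eq_one_of_cast_eq_neg_one (hSres s hsS hs2)

/-- **Pointwise form** (the shape a consumer at one pair uses): for `W/ℚ` elliptic and distinct odd primes
`p ≠ ℓ`, some prime `D ≡ 7 (mod 8)` off `{p, ℓ} ∪ primes(N_W)` has `(-D | p) = 1`, `(-D | ℓ) = -1` and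
`(-D | r) = 1` at the other odd bad primes `r`. [cite: BurungaleSkinnerTianWan2024, Thm. 2.5 (def)] -/
theorem exists_defConfig (W : WeierstrassCurve ℚ) [W.IsElliptic] {p ℓ : ℕ} (hp : p.Prime) (hℓ : ℓ.Prime)
    (hp2 : p ≠ 2) (hℓ2 : ℓ ≠ 2) (hpℓ : p ≠ ℓ) :
    ∃ D : ℕ, D.Prime ∧ D % 8 = 7 ∧ D ≠ p ∧ D ≠ ℓ ∧ ¬ (D ∣ W.conductorNorm ℤ) ∧
      jacobiSym (-(D : ℤ)) p = 1 ∧ jacobiSym (-(D : ℤ)) ℓ = -1 ∧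
      ∀ r : ℕ, r.Prime → r ≠ 2 → r ≠ ℓ → r ∣ W.conductorNorm ℤ → jacobiSym (-(D : ℤ)) r = 1 :=
  defFieldStatement W p ℓ hp hℓ hp2 hℓ2 hpℓ

end Summit.BirchSwinnertonDyer.BirchSwinnertonDyer.Theorems.LowerChamberDoor

end
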